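import Summits.AtomisticToContinuum.HydrodynamicLimit.Theses.RingDensityCertificate
import HarnessLib

/-!
# Birth skeleton (BC3) for crux `RingDensityCertificate.ContactChaos` (stmt-AtomisticToContinuum-12125)

Route: `route-AtomisticToContinuum-RingDensityCertificate` (sub-problem `HydrodynamicLimit`).
Crux (rank 0, auto-crux, ex target): `Summit.AtomisticToContinuum.HydrodynamicLimit.Theses.RingDensityCertificate.ContactChaos`
— the typed EMPIRICAL ENSKOG STOSSZAHLANSATZ along the deterministic hard-sphere flow at fixed reduced
density: in every mesoscopic cell `B(x₀,h)` and microscopic window `[t, t + w_N]` (`M` local kinetic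
time units), (SEL+ANG) the collision-sampled law of `(v_i⁻, v_j⁻, ω_ij)` equals the flux-biased
all-pairs reference built from the empirical one-particle data of the cell, and (RATE) the ordered
collision count equals the Enskog prediction with contact factor `g_E(n_cell σ³)`, both to tolerance
`δ` with probability `→ 1` as `N → ∞`, in the packing band `ρ_t(x)σ³ < η₀`.

## The cut registered here (2 stubs + kernel-checked assembly)

The crux is the conjunction of two physically and logically INDEPENDENT local-equilibrium statements
that different tools attack, glued under common thresholds `(η₀, σ₀, h₀)`:

* `stub_selectionChaos` — SEL+ANG: a statement about the TWO-PARTICLE VELOCITY–GEOMETRY law at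
  contact RELATIVE to the one-particle empirical law (factorisation of incoming velocities + hard-sphere
  flux weighting of the impact direction). Both sides are normalised, so it says nothing about the
  absolute collision frequency. This is the half the route's certificate crux `RingCertificate`
  (stmt-12128: `RingSparsity → RingDensityLaw → ContactChaos`) genuinely speaks to: correlations of
  incoming velocities are inherited through collision ANCESTRY (backward clusters, AokiEtAl2015 §1,
  PulvirentiSimonella2016/2021), and ring statistics control the recolliding minority. At
  Boltzmann–Grad it is Lanford's propagation of chaos read on the empirical collision measure.
* `stub_enskogRate` — RATE: the CONTACT VALUE of the empirical pair density in the cell is the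
  local-equilibrium one, `g_E(η) = (Z(η) − 1)/((2π/3)η)` at the EMPIRICAL cell density (virial
  theorem / hard-sphere equation of state, VanbeijerenErnst1973, Resibois1978). This is a
  CONFIGURATIONAL local-equilibrium statement at scale `h` over a window; velocities enter only
  through `|v_i − v_j|`. The ring certificate does not address it; its natural tools are the
  invariant-law comparison (proved supports `TiltTransfer` stmt-12131, `HomogeneousInvariance`
  stmt-9621) + an extensive equilibrium large deviation for the windowed contact-pair count
  (dependency-graph bound of `EquilibriumRingLD` type, Janson2004) for small data, and a
  configurational relative-entropy / local-Gibbs comparison in general.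

Independence (why this is a cut and not a seam): a state may have chaotic incoming velocities and a
wrong contact density (a quenched / layered configuration with Maxwellian velocities: SEL true, RATE
false), or the equilibrium contact density with correlated incoming velocities (shear-aligned pairs
at equilibrium packing: RATE true, SEL false). Neither stub implies the other, the crux, or the
Statement cheaply (BC3 probes, NOTES.md of the registrar session).

Assembly `ContactChaos_of` (sorry-free): merge the three nested existential thresholds of the two
halves (`η₀ := min η₁ η₂`, `σ₀ := min σ₁ σ₂`, `h₀ := min h₁ h₂`), re-derive the packing guard for
each half by monotonicity in `η₀`, and pair the two limits under the common `let`-bound functionals.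

File convention (as in `Cruxes/CollisionRate/Lines/Sketch.lean`): each registered stub is a NAMED statement
`def Stubs.stub_<name> : Prop := …` plus the sorried `theorem stub_<name> : <the same statement verbatim> := by sorry`;
the assembly `ContactChaos_of` takes the stubs BY NAME (`Stubs.stub_selectionChaos → Stubs.stub_enskogRate →
ContactChaos`, so the skeleton audit sees only declared stubs as hypotheses) and `ContactChaos_of_stubs` is the
hypothesis-free composition. BC3 probes (registrar folder `bc/*_probe_*.lean`, 2026-08-17): for each stub `S`,
`S → ContactChaos` and `S → _root_.HydrodynamicLimit` by `first | exact? | simpa [S] | (unfold S; simpa) | aesop`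
FAIL (rc 1; per tactic: `exact?` "could not close the goal", `simpa` heartbeat timeout, `aesop` "failed to prove the
goal after exhaustive search").

Disproof used: none exists for this crux (`ledger crux ls stmt-AtomisticToContinuum-12125`: no
workfiles, 2026-08-17). Dead lines: none recorded. Negatives index: no refuted statement of the summit
is restated by either stub (both keep the local-Gibbs tie and the packing guard of the crux verbatim;
stmt-9168's untied/unguarded quantification is not reintroduced).
-/

namespace Summit.AtomisticToContinuum.HydrodynamicLimit.Cruxes.ContactChaos.Birth

open scoped BigOperators Topology Manifold Classical MeasureTheory ProbabilityTheory Matrix InnerProductSpace ComplexConjugate ContinuousMap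
open Filter Set Function TopologicalSpace MeasureTheory

/-- stub 1 — SELECTION + ANGULAR CHAOS (the SEL+ANG half of the empirical Enskog Stosszahlansatz).
Same quantifier prefix as the crux (`∃ η₀` outermost, `∃ σ₀` after the profiles, `∃ h₀` after
`t, δ`); conclusion: for every continuous `|F| ≤ 1`, with `Sc N z F` the sum of
`F(v_i⁻, v_j⁻, ε⁻¹·sepVec)` over ordered collisions `(i,j)` in the window with `x_i ∈ B(x₀,h)` and
`Sr N z F` the flux-biased all-pairs reference `Σ_{i≠j in cell} ∫ F(v_i,v_j,ŷ)((v_i−v_j)·y)₋e^{−|y|²}dy`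
at time `t`, `P(δ·Sc(1)·Sr(1) < |Sc(F)·Sr(1) − Sr(F)·Sc(1)|) → 0` as `N → ∞`.
Why plausibly true: at fresh collisions the incoming pair descends from disjoint backward clusters,
so its joint law given the far field factorises; the recolliding minority has equilibrium statistics
in the sparse regime (the route's `RingCertificate` mechanism). Why it might fail: a persistent
`O(1)` velocity–position pattern at the free-path scale not of ring origin (streaming lanes under
strong shear); at finite `N` the defect is `O(φ·Kn)` (Lutsko1996). Size: XL.
Leans on: `Literature.Analysis.FluidPDE.HardSphereFlow`, `contactSet`, `Torus.geometry/euclidDist`,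
`Literature.MathematicalPhysics.KineticTheory.localGibbsLaw`, `IsHardSphereEulerSolution`,
`TendstoHydroFieldsAt`, `hsDiameter`; sources AokiEtAl2015, PulvirentiSimonella2016, Lutsko1996,
Bogolyubov1975, Spohn1991. -/
def Stubs.stub_selectionChaos : Prop :=
  ∃ η₀ : ℝ, 0 < η₀ ∧ ∀ (a₀ θ₀ : UnitAddTorus (Fin 3) → ℝ) (u₀ : UnitAddTorus (Fin 3) → EuclideanSpace ℝ (Fin 3)), Continuous a₀ → Continuous θ₀ → Continuous u₀ → (∀ x, 0 < a₀ x) → (∀ x, 0 < θ₀ x) → ∃ σ₀ : ℝ, 0 < σ₀ ∧ ∀ σ : ℝ, 0 < σ → σ < σ₀ → ∀ M : ℝ, 0 < M → ∀ (T : ℝ) (ρ θ : ℝ → UnitAddTorus (Fin 3) → ℝ) (u : ℝ → UnitAddTorus (Fin 3) → EuclideanSpace ℝ (Fin 3)), Literature.MathematicalPhysics.KineticTheory.IsHardSphereEulerSolution σ T ρ u θ → (∀ t ∈ Set.Ico 0 T, ∀ x, ρ t x * σ ^ 3 < η₀) → ∀ Φ : (N : ℕ) → Literature.Analysis.FluidPDE.HardSphereFlow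 (Literature.Analysis.FluidPDE.Torus.geometry (Fin 3)) (Literature.MathematicalPhysics.KineticTheory.hsDiameter σ N) (N + 1), Literature.MathematicalPhysics.KineticTheory.TendstoHydroFieldsAt (fun N => Literature.MathematicalPhysics.KineticTheory.localGibbsLaw σ a₀ u₀ θ₀ N (Φ N)) Φ ρ u θ 0 → ∀ t ∈ Set.Ico 0 T, ∀ δ : ℝ, 0 < δ → ∃ h₀ : ℝ, 0 < h₀ ∧ ∀ h : ℝ, 0 < h → h < h₀ → ∀ x₀ : UnitAddTorus (Fin 3), ∀ F : EuclideanSpace ℝ (Fin 3) → EuclideanSpace ℝ (Fin 3) → EuclideanSpace ℝ (Fin 3) → ℝ, Continuous (fun p : EuclideanSpace ℝ (Fin 3) × EuclideanSpace ℝ (Fin 3) × EuclideanSpace ℝ (Fin 3) => F p.1 p.2.1 p.2.2) → (∀ v v' ω, |F v v' ω| ≤ 1) → let w : ℕ → ℝ := fun N => M / (σ ^ 2 * (ρ t x₀ * Real.sqrt (θ t x₀) * ((N + 1 : ℕ) : ℝ) ^ (1 / 3 : ℝ))); let Sc := fun (N : ℕ) (z : Literature.Analysis.FluidPDE.Config (N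 + 1) (Fin 3) (UnitAddTorus (Fin 3))) (E : EuclideanSpace ℝ (Fin 3) → EuclideanSpace ℝ (Fin 3) → EuclideanSpace ℝ (Fin 3) → ℝ) => ∑ i : Fin (N + 1), ∑ j : Fin (N + 1), if i ≠ j then ∑ᶠ s ∈ {s : ℝ | s ∈ Set.Icc t (t + w N) ∧ (Φ N).flow s z ∈ Literature.Analysis.FluidPDE.contactSet (Literature.Analysis.FluidPDE.Torus.geometry (Fin 3)) (N + 1) (Literature.MathematicalPhysics.KineticTheory.hsDiameter σ N) i j ∧ Literature.Analysis.FluidPDE.Torus.euclidDist ((Φ N).flow s z i).1 x₀ < h}, E (Function.leftLim (fun s => (Φ N).flow s z) s i).2 (Function.leftLim (fun s => (Φ N).flow s z) s j).2 ((Literature.MathematicalPhysics.KineticTheory.hsDiameter σ N)⁻¹ • (Literature.Analysis.FluidPDE.Torus.geometry (Fin 3)).sepVec ((Φ N).flow s z i).1 ((Φ N).flow s z j).1) else 0; let Sr := fun (N : ℕ) (z : Literature.Analysis.FluidPDE.Config (N + 1) (Fin 3) (UnitAddTorus (Fin 3))) (E : EuclideanSpace ℝ (Fin 3) → EuclideanSpace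 ℝ (Fin 3) → EuclideanSpace ℝ (Fin 3) → ℝ) => ∑ i : Fin (N + 1), ∑ j : Fin (N + 1), if i ≠ j ∧ Literature.Analysis.FluidPDE.Torus.euclidDist ((Φ N).flow t z i).1 x₀ < h ∧ Literature.Analysis.FluidPDE.Torus.euclidDist ((Φ N).flow t z j).1 x₀ < h then ∫ y : EuclideanSpace ℝ (Fin 3), E ((Φ N).flow t z i).2 ((Φ N).flow t z j).2 (‖y‖⁻¹ • y) * max 0 (-(inner ℝ (((Φ N).flow t z i).2 - ((Φ N).flow t z j).2) y)) * Real.exp (-‖y‖ ^ 2) else 0; Filter.Tendsto (fun N : ℕ => Literature.MathematicalPhysics.KineticTheory.localGibbsLaw σ a₀ u₀ θ₀ N (Φ N) {z | δ * Sc N z 1 * Sr N z 1 < |Sc N z F * Sr N z 1 - Sr N z F * Sc N z 1|}) Filter.atTop (nhds 0)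

/-- Registered stub 1 (`Stubs.stub_selectionChaos`, verbatim): the `sorry` to be discharged. -/
theorem stub_selectionChaos : ∃ η₀ : ℝ, 0 < η₀ ∧ ∀ (a₀ θ₀ : UnitAddTorus (Fin 3) → ℝ) (u₀ : UnitAddTorus (Fin 3) → EuclideanSpace ℝ (Fin 3)), Continuous a₀ → Continuous θ₀ → Continuous u₀ → (∀ x, 0 < a₀ x) → (∀ x, 0 < θ₀ x) → ∃ σ₀ : ℝ, 0 < σ₀ ∧ ∀ σ : ℝ, 0 < σ → σ < σ₀ → ∀ M : ℝ, 0 < M → ∀ (T : ℝ) (ρ θ : ℝ → UnitAddTorus (Fin 3) → ℝ) (u : ℝ → UnitAddTorus (Fin 3) → EuclideanSpace ℝ (Fin 3)), Literature.MathematicalPhysics.KineticTheory.IsHardSphereEulerSolution σ T ρ u θ → (∀ t ∈ Set.Ico 0 T, ∀ x, ρ t x * σ ^ 3 < η₀) → ∀ Φ : (N : ℕ) → Literature.Analysis.FluidPDE.HardSphereFlow (Literature.Analysis.FluidPDE.Torus.geometry (Fin 3)) (Literature.MathematicalPhysics.KineticTheory.hsDiameter σ N) (N + 1), Literature.MathematicalPhysics.KineticTheory.TendstoHydroFieldsAt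 (fun N => Literature.MathematicalPhysics.KineticTheory.localGibbsLaw σ a₀ u₀ θ₀ N (Φ N)) Φ ρ u θ 0 → ∀ t ∈ Set.Ico 0 T, ∀ δ : ℝ, 0 < δ → ∃ h₀ : ℝ, 0 < h₀ ∧ ∀ h : ℝ, 0 < h → h < h₀ → ∀ x₀ : UnitAddTorus (Fin 3), ∀ F : EuclideanSpace ℝ (Fin 3) → EuclideanSpace ℝ (Fin 3) → EuclideanSpace ℝ (Fin 3) → ℝ, Continuous (fun p : EuclideanSpace ℝ (Fin 3) × EuclideanSpace ℝ (Fin 3) × EuclideanSpace ℝ (Fin 3) => F p.1 p.2.1 p.2.2) → (∀ v v' ω, |F v v' ω| ≤ 1) → let w : ℕ → ℝ := fun N => M / (σ ^ 2 * (ρ t x₀ * Real.sqrt (θ t x₀) * ((N + 1 : ℕ) : ℝ) ^ (1 / 3 : ℝ))); let Sc := fun (N : ℕ) (z : Literature.Analysis.FluidPDE.Config (N + 1) (Fin 3) (UnitAddTorus (Fin 3))) (E : EuclideanSpace ℝ (Fin 3) → EuclideanSpace ℝ (Fin 3) → EuclideanSpace ℝ (Fin 3) → ℝ) => ∑ i :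 Fin (N + 1), ∑ j : Fin (N + 1), if i ≠ j then ∑ᶠ s ∈ {s : ℝ | s ∈ Set.Icc t (t + w N) ∧ (Φ N).flow s z ∈ Literature.Analysis.FluidPDE.contactSet (Literature.Analysis.FluidPDE.Torus.geometry (Fin 3)) (N + 1) (Literature.MathematicalPhysics.KineticTheory.hsDiameter σ N) i j ∧ Literature.Analysis.FluidPDE.Torus.euclidDist ((Φ N).flow s z i).1 x₀ < h}, E (Function.leftLim (fun s => (Φ N).flow s z) s i).2 (Function.leftLim (fun s => (Φ N).flow s z) s j).2 ((Literature.MathematicalPhysics.KineticTheory.hsDiameter σ N)⁻¹ • (Literature.Analysis.FluidPDE.Torus.geometry (Fin 3)).sepVec ((Φ N).flow s z i).1 ((Φ N).flow s z j).1) else 0; let Sr := fun (N : ℕ) (z : Literature.Analysis.FluidPDE.Config (N + 1) (Fin 3) (UnitAddTorus (Fin 3))) (E : EuclideanSpace ℝ (Fin 3) → EuclideanSpace ℝ (Fin 3) → EuclideanSpace ℝ (Fin 3) → ℝ) => ∑ i : Fin (N + 1), ∑ j : Fin (N + 1), if i ≠ j ∧ Literature.Analysis.FluidPDE.Torus.euclidDist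 ((Φ N).flow t z i).1 x₀ < h ∧ Literature.Analysis.FluidPDE.Torus.euclidDist ((Φ N).flow t z j).1 x₀ < h then ∫ y : EuclideanSpace ℝ (Fin 3), E ((Φ N).flow t z i).2 ((Φ N).flow t z j).2 (‖y‖⁻¹ • y) * max 0 (-(inner ℝ (((Φ N).flow t z i).2 - ((Φ N).flow t z j).2) y)) * Real.exp (-‖y‖ ^ 2) else 0; Filter.Tendsto (fun N : ℕ => Literature.MathematicalPhysics.KineticTheory.localGibbsLaw σ a₀ u₀ θ₀ N (Φ N) {z | δ * Sc N z 1 * Sr N z 1 < |Sc N z F * Sr N z 1 - Sr N z F * Sc N z 1|}) Filter.atTop (nhds 0) := by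
  sorry

/-- stub 2 — ENSKOG COLLISION FREQUENCY (the RATE half): same prefix as the crux down to the cell
centre `x₀` (no test function is needed); conclusion: with `Sc N z 1` the ordered collision count in
`B(x₀,h) × [t, t + w_N]`, `nl N z` the empirical normalised cell density and `Pr N z` the Enskog
prediction `Σ_{i≠j in cell} π ε_N² |v_i − v_j| w_N g_E(nl·σ³)/|cell|`,
`g_E(η) = (hsCompressibility η − 1)/((2π/3)η)`, `P(δ·Pr < |Sc(1) − Pr|) → 0` as `N → ∞`.
Content: the contact value of the empirical pair density equals the local-equilibrium value at the
empirical cell density — a configurational local-equilibrium statement (virial theorem / hard-sphere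
EOS), independent of velocity factorisation. Why plausibly true: it holds under the invariant
homogeneous law with exponential concentration (windowed contact-pair count is an extensive
observable; dependency-graph LD), transfers to small local-Gibbs data for all times by the proved
`TiltTransfer` + `HomogeneousInvariance`, and is the `O(1)`-in-`Kn` part of Enskog theory in general.
Why it might fail: out of equilibrium the contact pair density carries an `O(Kn·|∇u|)` anisotropic
correction (collisional transfer, VanbeijerenErnst1973) that must average out over the cell/window;
a flow-generated contact-density excess at fixed packing (pre-crystalline layering under compression)
would refute it. Size: L (small data) / XL (general).
Leans on: as stub 1 plus `Literature.MathematicalPhysics.KineticTheory.hsCompressibility`; sources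
VanbeijerenErnst1973, Resibois1978, Janson2004, KipnisLandim1999, Lutsko1996. -/
def Stubs.stub_enskogRate : Prop :=
  ∃ η₀ : ℝ, 0 < η₀ ∧ ∀ (a₀ θ₀ : UnitAddTorus (Fin 3) → ℝ) (u₀ : UnitAddTorus (Fin 3) → EuclideanSpace ℝ (Fin 3)), Continuous a₀ → Continuous θ₀ → Continuous u₀ → (∀ x, 0 < a₀ x) → (∀ x, 0 < θ₀ x) → ∃ σ₀ : ℝ, 0 < σ₀ ∧ ∀ σ : ℝ, 0 < σ → σ < σ₀ → ∀ M : ℝ, 0 < M → ∀ (T : ℝ) (ρ θ : ℝ → UnitAddTorus (Fin 3) → ℝ) (u : ℝ → UnitAddTorus (Fin 3) → EuclideanSpace ℝ (Fin 3)), Literature.MathematicalPhysics.KineticTheory.IsHardSphereEulerSolution σ T ρ u θ → (∀ t ∈ Set.Ico 0 T, ∀ x, ρ t x * σ ^ 3 < η₀) → ∀ Φ : (N : ℕ) → Literature.Analysis.FluidPDE.HardSphereFlow (Literature.Analysis.FluidPDE.Torus.geometry (Fin 3)) (Literature.MathematicalPhysics.KineticTheory.hsDiameter σ N) (N + 1),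 Literature.MathematicalPhysics.KineticTheory.TendstoHydroFieldsAt (fun N => Literature.MathematicalPhysics.KineticTheory.localGibbsLaw σ a₀ u₀ θ₀ N (Φ N)) Φ ρ u θ 0 → ∀ t ∈ Set.Ico 0 T, ∀ δ : ℝ, 0 < δ → ∃ h₀ : ℝ, 0 < h₀ ∧ ∀ h : ℝ, 0 < h → h < h₀ → ∀ x₀ : UnitAddTorus (Fin 3), let w : ℕ → ℝ := fun N => M / (σ ^ 2 * (ρ t x₀ * Real.sqrt (θ t x₀) * ((N + 1 : ℕ) : ℝ) ^ (1 / 3 : ℝ))); let Sc := fun (N : ℕ) (z : Literature.Analysis.FluidPDE.Config (N + 1) (Fin 3) (UnitAddTorus (Fin 3))) (E : EuclideanSpace ℝ (Fin 3) → EuclideanSpace ℝ (Fin 3) → EuclideanSpace ℝ (Fin 3) → ℝ) => ∑ i : Fin (N + 1), ∑ j : Fin (N + 1), if i ≠ j then ∑ᶠ s ∈ {s : ℝ | s ∈ Set.Icc t (t + w N) ∧ (Φ N).flow s z ∈ Literature.Analysis.FluidPDE.contactSet (Literature.Analysis.FluidPDE.Torus.geometry (Fin 3)) (N + 1) (Literature.MathematicalPhysics.KineticTheory.hsDiameter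 σ N) i j ∧ Literature.Analysis.FluidPDE.Torus.euclidDist ((Φ N).flow s z i).1 x₀ < h}, E (Function.leftLim (fun s => (Φ N).flow s z) s i).2 (Function.leftLim (fun s => (Φ N).flow s z) s j).2 ((Literature.MathematicalPhysics.KineticTheory.hsDiameter σ N)⁻¹ • (Literature.Analysis.FluidPDE.Torus.geometry (Fin 3)).sepVec ((Φ N).flow s z i).1 ((Φ N).flow s z j).1) else 0; let nl := fun (N : ℕ) (z : Literature.Analysis.FluidPDE.Config (N + 1) (Fin 3) (UnitAddTorus (Fin 3))) => (∑ i : Fin (N + 1), if Literature.Analysis.FluidPDE.Torus.euclidDist ((Φ N).flow t z i).1 x₀ < h then (1 : ℝ) else 0) / ((N + 1 : ℝ) * (4 / 3 * Real.pi * h ^ 3)); let Pr := fun (N : ℕ) (z : Literature.Analysis.FluidPDE.Config (N + 1) (Fin 3) (UnitAddTorus (Fin 3))) => ∑ i : Fin (N + 1), ∑ j : Fin (N + 1), if i ≠ j ∧ Literature.Analysis.FluidPDE.Torus.euclidDist ((Φ N).flow t z i).1 x₀ < h ∧ Literature.Analysis.FluidPDE.Torus.euclidDist ((Φ N).flow t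 z j).1 x₀ < h then Real.pi * (Literature.MathematicalPhysics.KineticTheory.hsDiameter σ N) ^ 2 * ‖((Φ N).flow t z i).2 - ((Φ N).flow t z j).2‖ * w N * ((Literature.MathematicalPhysics.KineticTheory.hsCompressibility (nl N z * σ ^ 3) - 1) / (2 * Real.pi / 3 * (nl N z * σ ^ 3))) / (4 / 3 * Real.pi * h ^ 3) else 0; Filter.Tendsto (fun N : ℕ => Literature.MathematicalPhysics.KineticTheory.localGibbsLaw σ a₀ u₀ θ₀ N (Φ N) {z | δ * Pr N z < |Sc N z 1 - Pr N z|}) Filter.atTop (nhds 0)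

/-- Registered stub 2 (`Stubs.stub_enskogRate`, verbatim): the `sorry` to be discharged. -/
theorem stub_enskogRate : ∃ η₀ : ℝ, 0 < η₀ ∧ ∀ (a₀ θ₀ : UnitAddTorus (Fin 3) → ℝ) (u₀ : UnitAddTorus (Fin 3) → EuclideanSpace ℝ (Fin 3)), Continuous a₀ → Continuous θ₀ → Continuous u₀ → (∀ x, 0 < a₀ x) → (∀ x, 0 < θ₀ x) → ∃ σ₀ : ℝ, 0 < σ₀ ∧ ∀ σ : ℝ, 0 < σ → σ < σ₀ → ∀ M : ℝ, 0 < M → ∀ (T : ℝ) (ρ θ : ℝ → UnitAddTorus (Fin 3) → ℝ) (u : ℝ → UnitAddTorus (Fin 3) → EuclideanSpace ℝ (Fin 3)), Literature.MathematicalPhysics.KineticTheory.IsHardSphereEulerSolution σ T ρ u θ → (∀ t ∈ Set.Ico 0 T, ∀ x, ρ t x * σ ^ 3 < η₀) → ∀ Φ : (N : ℕ) → Literature.Analysis.FluidPDE.HardSphereFlow (Literature.Analysis.FluidPDE.Torus.geometry (Fin 3)) (Literature.MathematicalPhysics.KineticTheory.hsDiameter σ N) (N + 1), Literature.MathematicalPhysics.KineticTheory.TendstoHydroFieldsAt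 (fun N => Literature.MathematicalPhysics.KineticTheory.localGibbsLaw σ a₀ u₀ θ₀ N (Φ N)) Φ ρ u θ 0 → ∀ t ∈ Set.Ico 0 T, ∀ δ : ℝ, 0 < δ → ∃ h₀ : ℝ, 0 < h₀ ∧ ∀ h : ℝ, 0 < h → h < h₀ → ∀ x₀ : UnitAddTorus (Fin 3), let w : ℕ → ℝ := fun N => M / (σ ^ 2 * (ρ t x₀ * Real.sqrt (θ t x₀) * ((N + 1 : ℕ) : ℝ) ^ (1 / 3 : ℝ))); let Sc := fun (N : ℕ) (z : Literature.Analysis.FluidPDE.Config (N + 1) (Fin 3) (UnitAddTorus (Fin 3))) (E : EuclideanSpace ℝ (Fin 3) → EuclideanSpace ℝ (Fin 3) → EuclideanSpace ℝ (Fin 3) → ℝ) => ∑ i : Fin (N + 1), ∑ j : Fin (N + 1), if i ≠ j then ∑ᶠ s ∈ {s : ℝ | s ∈ Set.Icc t (t + w N) ∧ (Φ N).flow s z ∈ Literature.Analysis.FluidPDE.contactSet (Literature.Analysis.FluidPDE.Torus.geometry (Fin 3)) (N + 1) (Literature.MathematicalPhysics.KineticTheory.hsDiameter σ N) i j ∧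 Literature.Analysis.FluidPDE.Torus.euclidDist ((Φ N).flow s z i).1 x₀ < h}, E (Function.leftLim (fun s => (Φ N).flow s z) s i).2 (Function.leftLim (fun s => (Φ N).flow s z) s j).2 ((Literature.MathematicalPhysics.KineticTheory.hsDiameter σ N)⁻¹ • (Literature.Analysis.FluidPDE.Torus.geometry (Fin 3)).sepVec ((Φ N).flow s z i).1 ((Φ N).flow s z j).1) else 0; let nl := fun (N : ℕ) (z : Literature.Analysis.FluidPDE.Config (N + 1) (Fin 3) (UnitAddTorus (Fin 3))) => (∑ i : Fin (N + 1), if Literature.Analysis.FluidPDE.Torus.euclidDist ((Φ N).flow t z i).1 x₀ < h then (1 : ℝ) else 0) / ((N + 1 : ℝ) * (4 / 3 * Real.pi * h ^ 3)); let Pr := fun (N : ℕ) (z : Literature.Analysis.FluidPDE.Config (N + 1) (Fin 3) (UnitAddTorus (Fin 3))) => ∑ i : Fin (N + 1), ∑ j : Fin (N + 1), if i ≠ j ∧ Literature.Analysis.FluidPDE.Torus.euclidDist ((Φ N).flow t z i).1 x₀ < h ∧ Literature.Analysis.FluidPDE.Torus.euclidDist ((Φ N).flow t z j).1 x₀ <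 h then Real.pi * (Literature.MathematicalPhysics.KineticTheory.hsDiameter σ N) ^ 2 * ‖((Φ N).flow t z i).2 - ((Φ N).flow t z j).2‖ * w N * ((Literature.MathematicalPhysics.KineticTheory.hsCompressibility (nl N z * σ ^ 3) - 1) / (2 * Real.pi / 3 * (nl N z * σ ^ 3))) / (4 / 3 * Real.pi * h ^ 3) else 0; Filter.Tendsto (fun N : ℕ => Literature.MathematicalPhysics.KineticTheory.localGibbsLaw σ a₀ u₀ θ₀ N (Φ N) {z | δ * Pr N z < |Sc N z 1 - Pr N z|}) Filter.atTop (nhds 0) := by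
  sorry

/-- ASSEMBLY (kernel-checked, no `sorry`): the two halves, taken BY NAME (`Stubs.*`), give the crux BY NAME. Merge thresholds
(`min` at the three existential layers), push the packing guard `ρσ³ < min η₁ η₂` to each half, and
pair the two `Tendsto` conclusions under the crux's common `let`-bound functionals. -/
theorem ContactChaos_of : Stubs.stub_selectionChaos → Stubs.stub_enskogRate → Summit.AtomisticToContinuum.HydrodynamicLimit.Theses.RingDensityCertificate.ContactChaos := by
  intro hSel hRate
  obtain ⟨η₁, hη₁, H₁⟩ := hSel
  obtain ⟨η₂, hη₂, H₂⟩ := hRate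
  refine ⟨min η₁ η₂, lt_min hη₁ hη₂, ?_⟩
  intro a₀ θ₀ u₀ ha hθ hu hapos hθpos
  obtain ⟨σ₁, hσ₁, G₁⟩ := H₁ a₀ θ₀ u₀ ha hθ hu hapos hθpos
  obtain ⟨σ₂, hσ₂, G₂⟩ := H₂ a₀ θ₀ u₀ ha hθ hu hapos hθpos
  refine ⟨min σ₁ σ₂, lt_min hσ₁ hσ₂, ?_⟩
  intro σ hσ hσlt M hM T ρ θ u hsol hband Φ hLLN t ht δ hδ
  have hband₁ : ∀ s ∈ Set.Ico 0 T, ∀ x, ρ s x * σ ^ 3 < η₁ :=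
    fun s hs x => lt_of_lt_of_le (hband s hs x) (min_le_left _ _)
  have hband₂ : ∀ s ∈ Set.Ico 0 T, ∀ x, ρ s x * σ ^ 3 < η₂ :=
    fun s hs x => lt_of_lt_of_le (hband s hs x) (min_le_right _ _)
  obtain ⟨h₁, hh₁, K₁⟩ :=
    G₁ σ hσ (lt_of_lt_of_le hσlt (min_le_left _ _)) M hM T ρ θ u hsol hband₁ Φ hLLN t ht δ hδ
  obtain ⟨h₂, hh₂, K₂⟩ :=
    G₂ σ hσ (lt_of_lt_of_le hσlt (min_le_right _ _)) M hM T ρ θ u hsol hband₂ Φ hLLN t ht δ hδ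
  refine ⟨min h₁ h₂, lt_min hh₁ hh₂, ?_⟩
  intro h hh hhlt x₀ F hF hFb
  have A := K₁ h hh (lt_of_lt_of_le hhlt (min_le_left _ _)) x₀ F hF hFb
  have B := K₂ h hh (lt_of_lt_of_le hhlt (min_le_right _ _)) x₀
  exact ⟨A, B⟩

/-- The crux from the two registered stubs (hypothesis-free composition; type-checks that the verbatim stub statements
are definitionally the named `Stubs.*` hypotheses of `ContactChaos_of`; inherits the stubs' `sorry`s, states nothing new). -/
theorem ContactChaos_of_stubs : Summit.AtomisticToContinuum.HydrodynamicLimit.Theses.RingDensityCertificate.ContactChaos :=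
  ContactChaos_of stub_selectionChaos stub_enskogRate

end Summit.AtomisticToContinuum.HydrodynamicLimit.Cruxes.ContactChaos.Birth
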